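import Summits.QuantumFields.YangMills.Theorems.LuscherReductionTwistedTraceScalingBODefectRecordSplit
import Summits.QuantumFields.YangMills.Theorems.LuscherReductionTwistedTraceScalingBODefectRateAlgebra
import Summits.QuantumFields.YangMills.Theorems.LuscherReductionTwistedTraceScalingBOShellCurrency
import Summits.QuantumFields.YangMills.Theorems.LuscherReductionTwistedTraceScalingBODefect
import Summits.QuantumFields.YangMills.Theorems.LuscherReductionTwistedTraceScalingBODefectCoreData
import Summits.QuantumFields.YangMills.Theorems.LuscherReductionTwistedTraceScalingBOCentralModelBounds
import Summits.QuantumFields.YangMills.Theorems.LuscherReductionTwistedTraceScalingBOCentralWindow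
import HarnessLib

/-!
# (C4-CORE γ, step B) THE DEFECT CLAUSE `hdef` OF `hOD_of_defect` AT FIXED `β`, from the four piece bounds, the two currency floors and the quasimode floor
# (lane A of S-BASE, crux `TwistedTraceScaling` stmt-QuantumFields-20203, C4-CORE, the (OD) pen; `pub/ym-fleet/ym-luscher-20007-p1/HANDOFF-g20.md` (γ))

★★★ `hdef_fixed` — at fixed `β`: given the β-level outputs of `…BODefectCoreCurrency.core_defect_currency` (`hcore`), `…BODefectTailPiece.tail_sq_integral_le` (`htail`),
`…BODefectOutPiece.out_sq_integral_le_of_sep` (`hout`), `…BODefectShellB.shell_dualBO_sq_integral_le` (`hshell`), `…BOCurrencyFloor(Z).currency_floor(_inv)` (`hfl`, `hfl'`),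
`…BOBtCFloor.btC_floor_of_quasimode` (`hbtC`), `…BORecordGamma.tubeNormSq_record_ge` / `recordGamma_le_two_mul_inner` (`hnorm`, `hγ2`), `linkCE ≤ 2λ₀` (`hCE`), the soft weight floor
and the support facts (`hwS`, `hsupp`): for every bounded measurable `φ` supported in `orbitDist < 14β^{-s}/|Site|` there are `ψ` (the dual BO function of the core piece) and
`E = 𝟙_{χ≠0}(F/w − boFun ψ Ω_c)` with `F = (boFun ψ Ω_c + E)·w` on `{χ ≠ 0}` and `∫E²w ≤ (b·Λ')²·T`, `Λ' = btC·Z⁻¹/γ·λ₀`,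
`b = √(2(b_core² + b_T² + b_O² + b_B²))`, `b_T² = X_T'/Fl'`, `b_O² = X_O/Fl`, `b_B² = 8N_hiG/((1−η)²(1−κ_n)M₂in N̄)` — exactly the `hdef` clause of `…BODefect.hOD_of_defect` at `β`.
Composition of `…BODefectRecordSplit.record_defect_split`, `…BODefect.defect_of_weight_lower_bound`, `…BODefectRateAlgebra.piece_le_rate(_of_factor)`,
`…BOShellCurrency.sq_le_of_shell_currency`, `…BODefectSplit.defect_bound_of_pieces`.
HONEST FRAMING: bookkeeping for a stub of a child of the CONDITIONAL route R2b1; the eventual wrapper, (B-ST), C4-CORE remain OPEN; not a gap, not Clay.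
-/

set_option autoImplicit false

noncomputable section

open MeasureTheory Filter Topology Real
open scoped BigOperators
open Literature.MathematicalPhysics.QuantumFieldTheory
open Literature.MathematicalPhysics.QuantumLattice

namespace Summit.QuantumFields.YangMills.Theorems.FemtoTransferGap.TwoLattice.ConstTube

open Summit.QuantumFields.YangMills.Theorems.FemtoTransferGap
open Summit.QuantumFields.YangMills.Theorems.FemtoTransferGap.TwoLattice
open Summit.QuantumFields.YangMills.Theorems.FemtoTransferGap.TwoLattice.Avg
open Summit.QuantumFields.YangMills.Theorems.FemtoTransferGap.TwoLattice.Stiff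
open Summit.QuantumFields.YangMills.Theorems.FemtoTransferGap.TwoLattice.GnChart
open Summit.QuantumFields.YangMills.Theorems.FemtoTransferGap.TwoLattice.Cov

variable {L : ℕ} [NeZero L]

set_option maxHeartbeats 3200000 in
-- very large record expressions.
/-- ★★★ **THE DEFECT CLAUSE AT FIXED `β`** (see the module docstring). [cite: Luscher1983, §3] -/
theorem hdef_fixed {β : ℝ} (hβ0 : 0 < β) {s M D Dδ Cp Cq Cw Cn c₁ cR cR' w₀ : ℝ} {K K' : ℕ}
    (hCw : 0 ≤ Cw) (hKW : (Cw * (43 * powScale s β) ^ 2) < 1) (hKN : (Cn * (43 * powScale s β) ^ 2) < 1) (hη : powScale (1 / 5) β < 1) (hcR : 0 < cR) (hcR' : 0 < cR') (hc₁ : 0 < c₁)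
    (hM2 : 0 < (∫ v, {v : Edge 3 L → Fin 3 → ℝ | ‖linkEmbed L v‖ ≤ (min (1 / 40) (powScale (1 / 2) β * btLog β)) / 12}.indicator (fun _ => (1 : ℝ)) v * (Real.exp (-(stiffGaussExp L (β / 2) β (linkEmbed L v))) ^ 2 * Real.exp (-(‖(gaugeModes L).starProjection (linkEmbed L v)‖ ^ 2 / powScale 1 β ^ 2))) ∂orthoTransverse L)) (hγ0 : 0 < recordGamma L (fun β' => fun x : LinkSpace L => {x : LinkSpace L | linkCurry x ∈ capBalancedSet L}.indicator (fun _ => (1 : ℝ)) x * frozenProfile L (fun β'' => stiffGaussExp L (β'' / 2) β'') (fun β'' => min (1 / 40) (powScale (1 / 2) β'' * btLog β'')) β' x) β) (hw₀ : 0 < w₀)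
    (hwS : ∀ U, (recordChi L s 43 M β) U ≠ 0 → w₀ ≤ softWeight (recordChi L s 43 M β) U)
    (hsupp : ∀ U, (recordChi L s 43 M β) U ≠ 0 → U ∈ orthoTubeSet L ∧ (∀ k : Fin 3, ‖su2Quat (slowMean L U (0, k)) - 1‖ ≤ D * powScale s β) ∧
      (L : ℝ) ^ 3 * wilsonAction su2Rep (slowMean L U) ≤ powScale (2 * s) β)
    (hcore : ∀ φ : GaugeConfig 3 1 SU2 → ℝ, Measurable φ → ∀ Cφ : ℝ, (∀ u, |φ u| ≤ Cφ) → (∀ u, φ u ≠ 0 → orbitDist u < 14 * powScale s β / Fintype.card (Site 3 L)) → ∫ U, {U : GaugeConfig 3 L SU2 | U ∈ orthoTubeSet L ∧ (recordChi L s 43 M β) U ≠ 0 ∧ ‖relLinkVec L U‖ ≤ (min (1 / 40) (powScale (1 / 2) β * btLog β)) / 12 ∧ slowMean L U ∈ {u : GaugeConfig 3 1 SU2 | (∀ k : Fin 3, ‖su2Quat (u (0, k)) - 1‖ ≤ (D * powScale s β)) ∧ (L : ℝ) ^ 3 * wilsonAction su2Rep u ≤ (powScale (2 * s) β)}}.indicator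 (fun _ => (1 : ℝ)) U * (((fun U : GaugeConfig 3 L SU2 => (fpZ (powScale 1 β))⁻¹ * ∫ u, φ u * (∫ c, fpFibreTransfer L β (fun x : LinkSpace L => {x : LinkSpace L | linkCurry x ∈ capBalancedSet L}.indicator (fun _ => (1 : ℝ)) x * frozenProfile L (fun β' => stiffGaussExp L (β' / 2) β') (fun β' => min (1 / 40) (powScale (1 / 2) β' * btLog β')) β x) (coreWeight L (powScale 1 β) (5 * (powScale (1 / 2) β * btLog β ^ 2))) (gaugeTransform (fun _ : Site 3 L => c⁻¹) U) u ∂haarProbability SU2) ∂configMeasure SU2 1) U / softWeight (recordChi L s 43 M β) U - boFun L (fun u' => (fpZ (powScale 1 β))⁻¹ * (c₁ * stiffGaussTop L (β / 2) β / (∫ u, ({u : GaugeConfig 3 1 SU2 | (∀ k : Fin 3, ‖su2Quat (u (0, k)) - 1‖ ≤ (powScale (1 / 3) β)) ∧ (L : ℝ) ^ 3 * wilsonAction su2Rep u ≤ (powScale (1 / 2) β)}.indicator (fun _ => (1 : ℝ))) u * (transferKernel su2Rep ((L : ℝ) ^ 3 * β) (1 : GaugeConfig 3 1 SU2) u / transferKernel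 su2Rep ((L : ℝ) ^ 3 * β) (1 : GaugeConfig 3 1 SU2) 1) ∂configMeasure SU2 1)) / (fpWeightBar L (powScale 1 β)) * (∫ u, φ u * (avgKernel ((L : ℝ) ^ 3 * β) u' u / transferKernel su2Rep ((L : ℝ) ^ 3 * β) (1 : GaugeConfig 3 1 SU2) 1) ∂configMeasure SU2 1)) (fun x : LinkSpace L => {x : LinkSpace L | linkCurry x ∈ capBalancedSet L}.indicator (fun _ => (1 : ℝ)) x * frozenProfile L (fun β' => stiffGaussExp L (β' / 2) β') (fun β' => min (1 / 40) (powScale (1 / 2) β' * btLog β')) β x) U) ^ 2 * softWeight (recordChi L s 43 M β) U) ∂configMeasure SU2 L ≤ (((max (1 - Real.exp (-(coreEta L β (D * powScale s β) ((D * powScale s β) + (14 * powScale s β)) (9 * (L : ℝ) * (5 * (powScale (1 / 2) β * btLog β ^ 2)) + (powScale 1 β)) (min (1 / 40) (powScale (1 / 2) β * btLog β)) ((powScale 1 β) * Fintype.card (Site 3 L)) (powScale (2 * s) β) + coreEps1 L β (D * powScale s β) (9 * (L : ℝ) * (5 * (powScale (1 / 2) β * btLog β ^ 2)) + (powScale 1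 β)) (min (1 / 40) (powScale (1 / 2) β * btLog β)) + coreEps2 L β (D * powScale s β) (9 * (L : ℝ) * (5 * (powScale (1 / 2) β * btLog β ^ 2)) + (powScale 1 β)) (min (1 / 40) (powScale (1 / 2) β * btLog β)) (powScale (2 * s) β))) * (1 - powScale (1 / 5) β)) (Real.exp (coreEta L β (D * powScale s β) ((D * powScale s β) + (14 * powScale s β)) (9 * (L : ℝ) * (5 * (powScale (1 / 2) β * btLog β ^ 2)) + (powScale 1 β)) (min (1 / 40) (powScale (1 / 2) β * btLog β)) ((powScale 1 β) * Fintype.card (Site 3 L)) (powScale (2 * s) β) + coreEps1 L β (D * powScale s β) (9 * (L : ℝ) * (5 * (powScale (1 / 2) β * btLog β ^ 2)) + (powScale 1 β)) (min (1 / 40) (powScale (1 / 2) β * btLog β)) + coreEps2 L β (D * powScale s β) (9 * (L : ℝ) * (5 * (powScale (1 / 2) β * btLog β ^ 2)) + (powScale 1 β)) (min (1 / 40) (powScale (1 / 2) β * btLog β)) (powScale (2 * s) β)) * (1 + powScale (1 / 5) β) - 1) + (Cp * (43 * powScale s β) ^ 2)) * Real.sqrt (8 / ((1 - (Cp * (43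 * powScale s β) ^ 2)) * (1 - powScale (1 / 5) β) ^ 2 * (1 - (Cq * (43 * powScale s β) ^ 2))))) * (btC L β (fun x : LinkSpace L => {x : LinkSpace L | linkCurry x ∈ capBalancedSet L}.indicator (fun _ => (1 : ℝ)) x * frozenProfile L (fun β' => stiffGaussExp L (β' / 2) β') (fun β' => min (1 / 40) (powScale (1 / 2) β' * btLog β')) β x) (powScale 1 β) (5 * (powScale (1 / 2) β * btLog β ^ 2)) * (fpZ (powScale 1 β))⁻¹ / recordGamma L (fun β' => fun x : LinkSpace L => {x : LinkSpace L | linkCurry x ∈ capBalancedSet L}.indicator (fun _ => (1 : ℝ)) x * frozenProfile L (fun β'' => stiffGaussExp L (β'' / 2) β'') (fun β'' => min (1 / 40) (powScale (1 / 2) β'' * btLog β'')) β' x) β * levelValue su2Rep 1 ((L : ℝ) ^ 3 * β) 0)) ^ 2 * tubeNormSq (softWeight (recordChi L s 43 M β)) (boFun L φ (fun x : LinkSpace L => {x : LinkSpace L | linkCurry x ∈ capBalancedSet L}.indicator (fun _ => (1 : ℝ)) x * frozenProfile L (fun β' => stiffGaussExp L (β' / 2) β') (fun β' => min (1 / 40)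 (powScale (1 / 2) β' * btLog β')) β x)))
    (htail : ∀ φ : GaugeConfig 3 1 SU2 → ℝ, Measurable φ → ∀ Cφ : ℝ, (∀ u, |φ u| ≤ Cφ) → (∀ u, φ u ≠ 0 → orbitDist u < 14 * powScale s β / Fintype.card (Site 3 L)) → ∫ U, {U : GaugeConfig 3 L SU2 | U ∈ orthoTubeSet L ∧ (recordChi L s 43 M β) U ≠ 0 ∧ ‖relLinkVec L U‖ ≤ (min (1 / 40) (powScale (1 / 2) β * btLog β)) / 12 ∧ slowMean L U ∈ {u : GaugeConfig 3 1 SU2 | (∀ k : Fin 3, ‖su2Quat (u (0, k)) - 1‖ ≤ (D * powScale s β)) ∧ (L : ℝ) ^ 3 * wilsonAction su2Rep u ≤ (powScale (2 * s) β)}}.indicator (fun _ => (1 : ℝ)) U * ((fun U : GaugeConfig 3 L SU2 => (fpZ (powScale 1 β))⁻¹ * ∫ u, φ u * (∫ c, fpFibreTransfer L β (fun x : LinkSpace L => {x : LinkSpace L | linkCurry x ∈ capBalancedSet L}.indicator (fun _ => (1 : ℝ)) x * frozenProfile L (fun β' => stiffGaussExp L (β' / 2) β') (fun β' => min (1 /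 40) (powScale (1 / 2) β' * btLog β')) β x) (tailWeight L (powScale 1 β) (5 * (powScale (1 / 2) β * btLog β ^ 2))) (gaugeTransform (fun _ : Site 3 L => c⁻¹) U) u ∂haarProbability SU2) ∂configMeasure SU2 1) U ^ 2 / softWeight (recordChi L s 43 M β) U) ∂configMeasure SU2 L ≤ ((fpZ (powScale 1 β))⁻¹ * (Real.exp (β * (2 * (Fintype.card (Edge 3 L) : ℝ))) * (Real.exp (-(β * btMnt L (Dδ * powScale s β) (powScale (1 / 2) β * btLog β ^ 2) (min (1 / 40) (powScale (1 / 2) β * btLog β)) (5 * (powScale (1 / 2) β * btLog β ^ 2)) (powScale 1 β))) + Real.exp (-(β * btMfar L (Dδ * powScale s β) (powScale (1 / 2) β * btLog β ^ 2) (min (1 / 40) (powScale (1 / 2) β * btLog β)) (powScale 1 β) (13 * (Dδ * powScale s β))))) * ∫ v, (fun x : LinkSpace L => {x : LinkSpace L | linkCurry x ∈ capBalancedSet L}.indicator (fun _ => (1 : ℝ)) x * frozenProfile L (fun β' => stiffGaussExp L (β' / 2) β') (fun β' => min (1 / 40) (powScale (1 / 2) β' * btLog β')) β x) (linkEmbed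 L v) ∂orthoTransverse L)) ^ 2 * (1 / (fpWeightBar L (powScale 1 β) * (1 - (Cw * (43 * powScale s β) ^ 2)))) * ∫ u, φ u ^ 2 ∂configMeasure SU2 1)
    (hout : ∀ φ : GaugeConfig 3 1 SU2 → ℝ, Measurable φ → ∀ Cφ : ℝ, (∀ u, |φ u| ≤ Cφ) → (∀ u, φ u ≠ 0 → orbitDist u < 14 * powScale s β / Fintype.card (Site 3 L)) → ∫ U, (orthoTubeSet L ∩ {U | (recordChi L s 43 M β) U ≠ 0} ∩ {U | (min (1 / 40) (powScale (1 / 2) β * btLog β)) / 12 < ‖relLinkVec L U‖}).indicator (fun _ => (1 : ℝ)) U * ((∫ V, avgKernel β U V * boFun L φ (fun x : LinkSpace L => {x : LinkSpace L | linkCurry x ∈ capBalancedSet L}.indicator (fun _ => (1 : ℝ)) x * frozenProfile L (fun β' => stiffGaussExp L (β' / 2) β') (fun β' => min (1 / 40) (powScale (1 / 2) β' * btLog β')) β x) V ∂configMeasure SU2 L) ^ 2 / softWeight (recordChi L s 43 M β) U) ∂configMeasure SU2 L ≤ 3 * ((orthoTransverse L Set.univ).toReal * (1 / (fpWeightBar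 L (powScale 1 β) * (1 - (Cw * (43 * powScale s β) ^ 2)))) * ((Real.exp (2 * β) ^ Fintype.card (Edge 3 L)) ^ 2 * (Real.exp (-(β * (2 - 2 * Real.cos (2 * Real.pi / L)) * ((min (1 / 40) (powScale (1 / 2) β * btLog β)) / 12 / 2) ^ 2)) + Real.exp (-(((powScale 1 β) * btLog β) ^ 2 / powScale 1 β ^ 2)) ^ 2 + Real.exp (-(((powScale 1 β) * btLog β) ^ 2 / powScale 1 β ^ 2))) + (Real.exp (2 * β) ^ Fintype.card (Edge 3 L)) * ((Real.exp (2 * β) ^ Fintype.card (Edge 3 L)) * Real.exp (-(β * ((min (1 / 40) (powScale (1 / 2) β * btLog β)) / 1000) ^ 2)))) * ∫ u, φ u ^ 2 ∂configMeasure SU2 1))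
    (hshell : ∀ φ : GaugeConfig 3 1 SU2 → ℝ, Measurable φ → ∀ Cφ : ℝ, (∀ u, |φ u| ≤ Cφ) → (∀ u, φ u ≠ 0 → orbitDist u < 14 * powScale s β / Fintype.card (Site 3 L)) → ∫ U, (orthoTubeSet L ∩ {U | (recordChi L s 43 M β) U ≠ 0} ∩ {U | (min (1 / 40) (powScale (1 / 2) β * btLog β)) / 12 < ‖relLinkVec L U‖}).indicator (fun _ => (1 : ℝ)) U * (boFun L (fun u' => (fpZ (powScale 1 β))⁻¹ * (c₁ * stiffGaussTop L (β / 2) β / (∫ u, ({u : GaugeConfig 3 1 SU2 | (∀ k : Fin 3, ‖su2Quat (u (0, k)) - 1‖ ≤ (powScale (1 / 3) β)) ∧ (L : ℝ) ^ 3 * wilsonAction su2Rep u ≤ (powScale (1 / 2) β)}.indicator (fun _ => (1 : ℝ))) u * (transferKernel su2Rep ((L : ℝ) ^ 3 * β) (1 : GaugeConfig 3 1 SU2) u / transferKernel su2Rep ((L : ℝ) ^ 3 * β) (1 : GaugeConfig 3 1 SU2) 1) ∂configMeasure SU2 1)) / (fpWeightBar L (powScale 1 β)) * (∫ u, φ u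 * (avgKernel ((L : ℝ) ^ 3 * β) u' u / transferKernel su2Rep ((L : ℝ) ^ 3 * β) (1 : GaugeConfig 3 1 SU2) 1) ∂configMeasure SU2 1)) (fun x : LinkSpace L => {x : LinkSpace L | linkCurry x ∈ capBalancedSet L}.indicator (fun _ => (1 : ℝ)) x * frozenProfile L (fun β' => stiffGaussExp L (β' / 2) β') (fun β' => min (1 / 40) (powScale (1 / 2) β' * btLog β')) β x) U ^ 2 * softWeight (recordChi L s 43 M β) U) ∂configMeasure SU2 L ≤ (fpWeightBar L (powScale 1 β) * (1 + (Cw * (43 * powScale s β) ^ 2))) * Real.exp (-(β * (2 - 2 * Real.cos (2 * Real.pi / L)) * ((min (1 / 40) (powScale (1 / 2) β * btLog β)) / 12) ^ 2)) * (orthoTransverse L Set.univ).toReal * (((fpZ (powScale 1 β))⁻¹ * (c₁ * stiffGaussTop L (β / 2) β / (∫ u, ({u : GaugeConfig 3 1 SU2 | (∀ k : Fin 3, ‖su2Quat (u (0, k)) - 1‖ ≤ (powScale (1 / 3) β)) ∧ (L : ℝ) ^ 3 * wilsonAction su2Rep u ≤ (powScale (1 / 2) β)}.indicator (fun _ =>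 (1 : ℝ))) u * (transferKernel su2Rep ((L : ℝ) ^ 3 * β) (1 : GaugeConfig 3 1 SU2) u / transferKernel su2Rep ((L : ℝ) ^ 3 * β) (1 : GaugeConfig 3 1 SU2) 1) ∂configMeasure SU2 1)) / (fpWeightBar L (powScale 1 β))) ^ 2 * ((linkCE ((L : ℝ) ^ 3 * β) / transferKernel su2Rep ((L : ℝ) ^ 3 * β) (1 : GaugeConfig 3 1 SU2) 1) ^ 2 * ∫ u, φ u ^ 2 ∂configMeasure SU2 1)))
    (hfl : ∀ φ : GaugeConfig 3 1 SU2 → ℝ, Measurable φ → ∀ Cφ : ℝ, (∀ u, |φ u| ≤ Cφ) → (∀ u, φ u ≠ 0 → orbitDist u < 14 * powScale s β / Fintype.card (Site 3 L)) → (cR * powScale 1 β ^ K * (Real.exp (2 * β) ^ Fintype.card (Edge 3 L)) ^ 2) * ∫ u, φ u ^ 2 ∂configMeasure SU2 1 ≤ (btC L β (fun x : LinkSpace L => {x : LinkSpace L | linkCurry x ∈ capBalancedSet L}.indicator (fun _ => (1 : ℝ)) x * frozenProfile L (fun β' => stiffGaussExp L (β' / 2) β') (fun β' => min (1 / 40)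 (powScale (1 / 2) β' * btLog β')) β x) (powScale 1 β) (5 * (powScale (1 / 2) β * btLog β ^ 2)) / fpZ (powScale 1 β) / recordGamma L (fun β' => fun x : LinkSpace L => {x : LinkSpace L | linkCurry x ∈ capBalancedSet L}.indicator (fun _ => (1 : ℝ)) x * frozenProfile L (fun β'' => stiffGaussExp L (β'' / 2) β'') (fun β'' => min (1 / 40) (powScale (1 / 2) β'' * btLog β'')) β' x) β * levelValue su2Rep 1 ((L : ℝ) ^ 3 * β) 0) ^ 2 * tubeNormSq (softWeight (recordChi L s 43 M β)) (boFun L φ (fun x : LinkSpace L => {x : LinkSpace L | linkCurry x ∈ capBalancedSet L}.indicator (fun _ => (1 : ℝ)) x * frozenProfile L (fun β' => stiffGaussExp L (β' / 2) β') (fun β' => min (1 / 40) (powScale (1 / 2) β' * btLog β')) β x)))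
    (hfl' : ∀ φ : GaugeConfig 3 1 SU2 → ℝ, Measurable φ → ∀ Cφ : ℝ, (∀ u, |φ u| ≤ Cφ) → (∀ u, φ u ≠ 0 → orbitDist u < 14 * powScale s β / Fintype.card (Site 3 L)) → (cR' * powScale 1 β ^ K' * (Real.exp (2 * β) ^ Fintype.card (Edge 3 L)) ^ 2) * (fpZ (powScale 1 β))⁻¹ ^ 2 * ∫ u, φ u ^ 2 ∂configMeasure SU2 1 ≤ (btC L β (fun x : LinkSpace L => {x : LinkSpace L | linkCurry x ∈ capBalancedSet L}.indicator (fun _ => (1 : ℝ)) x * frozenProfile L (fun β' => stiffGaussExp L (β' / 2) β') (fun β' => min (1 / 40) (powScale (1 / 2) β' * btLog β')) β x) (powScale 1 β) (5 * (powScale (1 / 2) β * btLog β ^ 2)) / fpZ (powScale 1 β) / recordGamma L (fun β' => fun x : LinkSpace L => {x : LinkSpace L | linkCurry x ∈ capBalancedSet L}.indicator (fun _ => (1 : ℝ)) x * frozenProfile L (fun β'' => stiffGaussExp L (β'' / 2) β'') (fun β'' => min (1 / 40) (powScale (1 / 2) β'' * btLog β'')) β' x) β * levelValue su2Rep 1 ((L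 : ℝ) ^ 3 * β) 0) ^ 2 * tubeNormSq (softWeight (recordChi L s 43 M β)) (boFun L φ (fun x : LinkSpace L => {x : LinkSpace L | linkCurry x ∈ capBalancedSet L}.indicator (fun _ => (1 : ℝ)) x * frozenProfile L (fun β' => stiffGaussExp L (β' / 2) β') (fun β' => min (1 / 40) (powScale (1 / 2) β' * btLog β')) β x)))
    (hbtC : (1 - powScale (1 / 5) β) * (c₁ * stiffGaussTop L (β / 2) β / (∫ u, ({u : GaugeConfig 3 1 SU2 | (∀ k : Fin 3, ‖su2Quat (u (0, k)) - 1‖ ≤ (powScale (1 / 3) β)) ∧ (L : ℝ) ^ 3 * wilsonAction su2Rep u ≤ (powScale (1 / 2) β)}.indicator (fun _ => (1 : ℝ))) u * (transferKernel su2Rep ((L : ℝ) ^ 3 * β) (1 : GaugeConfig 3 1 SU2) u / transferKernel su2Rep ((L : ℝ) ^ 3 * β) (1 : GaugeConfig 3 1 SU2) 1) ∂configMeasure SU2 1)) * (∫ v, {v : Edge 3 L → Fin 3 → ℝ | ‖linkEmbed L v‖ ≤ (min (1 / 40) (powScale (1 / 2) β * btLog β)) / 12}.indicator (fun _ => (1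 : ℝ)) v * (Real.exp (-(stiffGaussExp L (β / 2) β (linkEmbed L v))) ^ 2 * Real.exp (-(‖(gaugeModes L).starProjection (linkEmbed L v)‖ ^ 2 / powScale 1 β ^ 2))) ∂orthoTransverse L) ≤ btC L β (fun x : LinkSpace L => {x : LinkSpace L | linkCurry x ∈ capBalancedSet L}.indicator (fun _ => (1 : ℝ)) x * frozenProfile L (fun β' => stiffGaussExp L (β' / 2) β') (fun β' => min (1 / 40) (powScale (1 / 2) β' * btLog β')) β x) (powScale 1 β) (5 * (powScale (1 / 2) β * btLog β ^ 2)) * transferKernel su2Rep ((L : ℝ) ^ 3 * β) (1 : GaugeConfig 3 1 SU2) 1)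
    (hnorm : ∀ φ : GaugeConfig 3 1 SU2 → ℝ, Measurable φ → ∀ Cφ : ℝ, (∀ u, |φ u| ≤ Cφ) → (∀ u, φ u ≠ 0 → orbitDist u < 14 * powScale s β / Fintype.card (Site 3 L)) → (1 - (Cn * (43 * powScale s β) ^ 2)) * recordGamma L (fun β' => fun x : LinkSpace L => {x : LinkSpace L | linkCurry x ∈ capBalancedSet L}.indicator (fun _ => (1 : ℝ)) x * frozenProfile L (fun β'' => stiffGaussExp L (β'' / 2) β'') (fun β'' => min (1 / 40) (powScale (1 / 2) β'' * btLog β'')) β' x) β * ∫ u, φ u ^ 2 ∂configMeasure SU2 1 ≤ tubeNormSq (softWeight (recordChi L s 43 M β)) (boFun L φ (fun x : LinkSpace L => {x : LinkSpace L | linkCurry x ∈ capBalancedSet L}.indicator (fun _ => (1 : ℝ)) x * frozenProfile L (fun β' => stiffGaussExp L (β' / 2) β') (fun β' => min (1 / 40) (powScale (1 / 2) β' * btLog β')) β x)))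
    (hγ2 : recordGamma L (fun β' => fun x : LinkSpace L => {x : LinkSpace L | linkCurry x ∈ capBalancedSet L}.indicator (fun _ => (1 : ℝ)) x * frozenProfile L (fun β'' => stiffGaussExp L (β'' / 2) β'') (fun β'' => min (1 / 40) (powScale (1 / 2) β'' * btLog β'')) β' x) β ≤ 2 * (fpWeightBar L (powScale 1 β) * (∫ v, {v : Edge 3 L → Fin 3 → ℝ | ‖linkEmbed L v‖ ≤ (min (1 / 40) (powScale (1 / 2) β * btLog β)) / 12}.indicator (fun _ => (1 : ℝ)) v * (Real.exp (-(stiffGaussExp L (β / 2) β (linkEmbed L v))) ^ 2 * Real.exp (-(‖(gaugeModes L).starProjection (linkEmbed L v)‖ ^ 2 / powScale 1 β ^ 2))) ∂orthoTransverse L))) (hCE : linkCE ((L : ℝ) ^ 3 * β) ≤ 2 * levelValue su2Rep 1 ((L : ℝ) ^ 3 * β) 0) :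
    ∀ φ : GaugeConfig 3 1 SU2 → ℝ, Measurable φ → (∃ C : ℝ, ∀ u, |φ u| ≤ C) → (∀ u, φ u ≠ 0 → orbitDist u < 14 * powScale s β / Fintype.card (Site 3 L)) →
      ∃ (ψ : GaugeConfig 3 1 SU2 → ℝ) (E : GaugeConfig 3 L SU2 → ℝ), Measurable ψ ∧ (∃ C : ℝ, ∀ u, |ψ u| ≤ C) ∧ Measurable E ∧ (∃ C : ℝ, ∀ U, |E U| ≤ C) ∧
        (∀ U, (recordChi L s 43 M β) U ≠ 0 → (∫ V, avgKernel β U V * boFun L φ (fun x : LinkSpace L => {x : LinkSpace L | linkCurry x ∈ capBalancedSet L}.indicator (fun _ => (1 : ℝ)) x * frozenProfile L (fun β' => stiffGaussExp L (β' / 2) β') (fun β' => min (1 / 40) (powScale (1 / 2) β' * btLog β')) β x) V ∂configMeasure SU2 L) = (boFun L ψ (fun x : LinkSpace L => {x : LinkSpace L | linkCurry x ∈ capBalancedSet L}.indicator (fun _ => (1 : ℝ)) x * frozenProfile L (fun β' => stiffGaussExp L (β' / 2) β') (fun β' => min (1 / 40) (powScale (1 / 2) β' * btLog β')) β x) U +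 E U) * softWeight (recordChi L s 43 M β) U) ∧
        ∫ U, E U ^ 2 * softWeight (recordChi L s 43 M β) U ∂configMeasure SU2 L ≤ (Real.sqrt (2 * (((max (1 - Real.exp (-(coreEta L β (D * powScale s β) ((D * powScale s β) + (14 * powScale s β)) (9 * (L : ℝ) * (5 * (powScale (1 / 2) β * btLog β ^ 2)) + (powScale 1 β)) (min (1 / 40) (powScale (1 / 2) β * btLog β)) ((powScale 1 β) * Fintype.card (Site 3 L)) (powScale (2 * s) β) + coreEps1 L β (D * powScale s β) (9 * (L : ℝ) * (5 * (powScale (1 / 2) β * btLog β ^ 2)) + (powScale 1 β)) (min (1 / 40) (powScale (1 / 2) β * btLog β)) + coreEps2 L β (D * powScale s β) (9 * (L : ℝ) * (5 * (powScale (1 / 2) β * btLog β ^ 2)) + (powScale 1 β)) (min (1 / 40) (powScale (1 / 2) β * btLog β)) (powScale (2 * s) β))) * (1 - powScale (1 / 5) β)) (Real.exp (coreEta L β (D * powScale s β) ((D * powScale s β) + (14 * powScale s β)) (9 * (L : ℝ) * (5 * (powScale (1 / 2) β * btLog β ^ 2)) + (powScale 1 β)) (min (1 / 40) (powScale (1 /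 2) β * btLog β)) ((powScale 1 β) * Fintype.card (Site 3 L)) (powScale (2 * s) β) + coreEps1 L β (D * powScale s β) (9 * (L : ℝ) * (5 * (powScale (1 / 2) β * btLog β ^ 2)) + (powScale 1 β)) (min (1 / 40) (powScale (1 / 2) β * btLog β)) + coreEps2 L β (D * powScale s β) (9 * (L : ℝ) * (5 * (powScale (1 / 2) β * btLog β ^ 2)) + (powScale 1 β)) (min (1 / 40) (powScale (1 / 2) β * btLog β)) (powScale (2 * s) β)) * (1 + powScale (1 / 5) β) - 1) + (Cp * (43 * powScale s β) ^ 2)) * Real.sqrt (8 / ((1 - (Cp * (43 * powScale s β) ^ 2)) * (1 - powScale (1 / 5) β) ^ 2 * (1 - (Cq * (43 * powScale s β) ^ 2))))) ^ 2 + Real.sqrt (((Real.exp (β * (2 * (Fintype.card (Edge 3 L) : ℝ))) * (Real.exp (-(β * btMnt L (Dδ * powScale s β) (powScale (1 / 2) β * btLog β ^ 2) (min (1 / 40) (powScale (1 / 2) β * btLog β)) (5 * (powScale (1 / 2) β * btLog β ^ 2)) (powScale 1 β))) + Real.exp (-(β * btMfar L (Dδ * powScale s β) (powScale (1 / 2)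 β * btLog β ^ 2) (min (1 / 40) (powScale (1 / 2) β * btLog β)) (powScale 1 β) (13 * (Dδ * powScale s β))))) * ∫ v, (fun x : LinkSpace L => {x : LinkSpace L | linkCurry x ∈ capBalancedSet L}.indicator (fun _ => (1 : ℝ)) x * frozenProfile L (fun β' => stiffGaussExp L (β' / 2) β') (fun β' => min (1 / 40) (powScale (1 / 2) β' * btLog β')) β x) (linkEmbed L v) ∂orthoTransverse L) ^ 2 * (1 / (fpWeightBar L (powScale 1 β) * (1 - (Cw * (43 * powScale s β) ^ 2))))) / (cR' * powScale 1 β ^ K' * (Real.exp (2 * β) ^ Fintype.card (Edge 3 L)) ^ 2)) ^ 2 + Real.sqrt ((3 * ((orthoTransverse L Set.univ).toReal * (1 / (fpWeightBar L (powScale 1 β) * (1 - (Cw * (43 * powScale s β) ^ 2)))) * ((Real.exp (2 * β) ^ Fintype.card (Edge 3 L)) ^ 2 * (Real.exp (-(β * (2 - 2 * Real.cos (2 * Real.pi / L)) * ((min (1 / 40) (powScale (1 / 2) β * btLog β)) / 12 / 2) ^ 2)) + Real.exp (-(((powScale 1 β) * btLog β) ^ 2 / powScale 1 β ^ 2)) ^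 2 + Real.exp (-(((powScale 1 β) * btLog β) ^ 2 / powScale 1 β ^ 2))) + (Real.exp (2 * β) ^ Fintype.card (Edge 3 L)) * ((Real.exp (2 * β) ^ Fintype.card (Edge 3 L)) * Real.exp (-(β * ((min (1 / 40) (powScale (1 / 2) β * btLog β)) / 1000) ^ 2)))))) / (cR * powScale 1 β ^ K * (Real.exp (2 * β) ^ Fintype.card (Edge 3 L)) ^ 2)) ^ 2 + Real.sqrt (8 * (fpWeightBar L (powScale 1 β) * (1 + (Cw * (43 * powScale s β) ^ 2))) * (Real.exp (-(β * (2 - 2 * Real.cos (2 * Real.pi / L)) * ((min (1 / 40) (powScale (1 / 2) β * btLog β)) / 12) ^ 2)) * (orthoTransverse L Set.univ).toReal) / ((1 - powScale (1 / 5) β) ^ 2 * (1 - (Cn * (43 * powScale s β) ^ 2)) * (∫ v, {v : Edge 3 L → Fin 3 → ℝ | ‖linkEmbed L v‖ ≤ (min (1 / 40) (powScale (1 / 2) β * btLog β)) / 12}.indicator (fun _ => (1 : ℝ)) v * (Real.exp (-(stiffGaussExp L (β / 2) β (linkEmbed L v))) ^ 2 * Real.exp (-(‖(gaugeModes L).starProjection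 (linkEmbed L v)‖ ^ 2 / powScale 1 β ^ 2))) ∂orthoTransverse L) * fpWeightBar L (powScale 1 β))) ^ 2)) * (btC L β (fun x : LinkSpace L => {x : LinkSpace L | linkCurry x ∈ capBalancedSet L}.indicator (fun _ => (1 : ℝ)) x * frozenProfile L (fun β' => stiffGaussExp L (β' / 2) β') (fun β' => min (1 / 40) (powScale (1 / 2) β' * btLog β')) β x) (powScale 1 β) (5 * (powScale (1 / 2) β * btLog β ^ 2)) * (fpZ (powScale 1 β))⁻¹ / recordGamma L (fun β' => fun x : LinkSpace L => {x : LinkSpace L | linkCurry x ∈ capBalancedSet L}.indicator (fun _ => (1 : ℝ)) x * frozenProfile L (fun β'' => stiffGaussExp L (β'' / 2) β'') (fun β'' => min (1 / 40) (powScale (1 / 2) β'' * btLog β'')) β' x) β * levelValue su2Rep 1 ((L : ℝ) ^ 3 * β) 0)) ^ 2 * tubeNormSq (softWeight (recordChi L s 43 M β)) (boFun L φ (fun x : LinkSpace L => {x : LinkSpace L | linkCurry x ∈ capBalancedSet L}.indicator (fun _ => (1 : ℝ)) x * frozenProfile L (fun β' => stiffGaussExp L (β' / 2) β') (fun β' =>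 min (1 / 40) (powScale (1 / 2) β' * btLog β')) β x)) := by
  intro φ hφm hφb hφs
  obtain ⟨Cφ, hCφ⟩ := hφb
  haveI := isFiniteMeasure_orthoTransverse L
  obtain ⟨hχm, hχ1, hχ0, -⟩ := recordChi_props (L := L) s 43 M β
  obtain ⟨hwm, hwb, hw0, -⟩ := softWeight_recordChi_props (L := L) s 43 M β
  -- the profile
  have hqfm : ∀ β', Measurable ((fun β' => stiffGaussExp L (β' / 2) β') β') := fun β' => measurable_stiffGaussExp _ _
  have hqf0 : ∀ β' x, 0 ≤ (fun β' => stiffGaussExp L (β' / 2) β') β' x := fun β' x => stiffGaussExp_nonneg _ _ x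
  have hΩGm : Measurable (frozenProfile L (fun β' => stiffGaussExp L (β' / 2) β') (fun β' => min (1 / 40) (powScale (1 / 2) β' * btLog β')) β) := measurable_frozenProfile hqfm _ β
  have hΩG0 : ∀ x, 0 ≤ frozenProfile L (fun β' => stiffGaussExp L (β' / 2) β') (fun β' => min (1 / 40) (powScale (1 / 2) β' * btLog β')) β x := fun x => (frozenProfile_mem_Icc hqf0 _ β x).1
  have hΩG1 : ∀ x, |frozenProfile L (fun β' => stiffGaussExp L (β' / 2) β') (fun β' => min (1 / 40) (powScale (1 / 2) β' * btLog β')) β x| ≤ 1 := abs_frozenProfile_le hqf0 _ β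
  have hΩm : Measurable (fun x : LinkSpace L => {x : LinkSpace L | linkCurry x ∈ capBalancedSet L}.indicator (fun _ => (1 : ℝ)) x * frozenProfile L (fun β' => stiffGaussExp L (β' / 2) β') (fun β' => min (1 / 40) (powScale (1 / 2) β' * btLog β')) β x) := measurable_capRestrict (L := L) hΩGm
  have hΩ1 : ∀ x, |(fun x : LinkSpace L => {x : LinkSpace L | linkCurry x ∈ capBalancedSet L}.indicator (fun _ => (1 : ℝ)) x * frozenProfile L (fun β' => stiffGaussExp L (β' / 2) β') (fun β' => min (1 / 40) (powScale (1 / 2) β' * btLog β')) β x) x| ≤ 1 := fun x => (capRestrict_mem (L := L) hΩG0 hΩG1 x).2.2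
  -- positivity of the data
  have hZi : 0 < (fpZ (powScale 1 β))⁻¹ := inv_pos.2 (fpZ_pos (powScale_pos 1 β))
  have hNb : 0 < fpWeightBar L (powScale 1 β) := fpWeightBar_pos L (powScale_pos 1 β)
  have hK1 : 0 < transferKernel su2Rep ((L : ℝ) ^ 3 * β) (1 : GaugeConfig 3 1 SU2) 1 := transferKernel_pos _ _ _ _
  obtain ⟨hSlo, -⟩ := stiffGaussTop_record_bounds (L := L) hβ0
  have hS : 0 < stiffGaussTop L (β / 2) β := lt_of_lt_of_le (pow_pos (Real.sqrt_pos.2 (by positivity)) _) hSlo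
  have hI0 : 0 < (∫ u, ({u : GaugeConfig 3 1 SU2 | (∀ k : Fin 3, ‖su2Quat (u (0, k)) - 1‖ ≤ (powScale (1 / 3) β)) ∧ (L : ℝ) ^ 3 * wilsonAction su2Rep u ≤ (powScale (1 / 2) β)}.indicator (fun _ => (1 : ℝ))) u * (transferKernel su2Rep ((L : ℝ) ^ 3 * β) (1 : GaugeConfig 3 1 SU2) u / transferKernel su2Rep ((L : ℝ) ^ 3 * β) (1 : GaugeConfig 3 1 SU2) 1) ∂configMeasure SU2 1) := slowWindow_I0_pos (L := L) (powScale_pos (1 / 3) β) (powScale_pos (1 / 2) β) ((L : ℝ) ^ 3 * β)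
  have ha₀ : 0 ≤ (c₁ * stiffGaussTop L (β / 2) β / (∫ u, ({u : GaugeConfig 3 1 SU2 | (∀ k : Fin 3, ‖su2Quat (u (0, k)) - 1‖ ≤ (powScale (1 / 3) β)) ∧ (L : ℝ) ^ 3 * wilsonAction su2Rep u ≤ (powScale (1 / 2) β)}.indicator (fun _ => (1 : ℝ))) u * (transferKernel su2Rep ((L : ℝ) ^ 3 * β) (1 : GaugeConfig 3 1 SU2) u / transferKernel su2Rep ((L : ℝ) ^ 3 * β) (1 : GaugeConfig 3 1 SU2) 1) ∂configMeasure SU2 1)) := by positivity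
  have hφ2 : 0 ≤ ∫ u, φ u ^ 2 ∂configMeasure SU2 1 := integral_nonneg fun u => sq_nonneg _
  have hKW1 : 0 < 1 - (Cw * (43 * powScale s β) ^ 2) := by linarith
  have hcg0 : 0 ≤ (1 / (fpWeightBar L (powScale 1 β) * (1 - (Cw * (43 * powScale s β) ^ 2)))) := by positivity
  have hPm0 : 0 ≤ (orthoTransverse L Set.univ).toReal := ENNReal.toReal_nonneg
  have hCE0 : 0 ≤ linkCE ((L : ℝ) ^ 3 * β) := (linkCE_pos (by positivity)).le
  -- the dual BO function `ψ`
  set ψ : GaugeConfig 3 1 SU2 → ℝ := (fun u' => (fpZ (powScale 1 β))⁻¹ * (c₁ * stiffGaussTop L (β / 2) β / (∫ u, ({u : GaugeConfig 3 1 SU2 | (∀ k : Fin 3, ‖su2Quat (u (0, k)) - 1‖ ≤ (powScale (1 / 3) β)) ∧ (L : ℝ) ^ 3 * wilsonAction su2Rep u ≤ (powScale (1 / 2) β)}.indicator (fun _ => (1 : ℝ))) u * (transferKernel su2Rep ((L : ℝ) ^ 3 * β) (1 : GaugeConfig 3 1 SU2) u / transferKernel su2Rep ((L : ℝ) ^ 3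 * β) (1 : GaugeConfig 3 1 SU2) 1) ∂configMeasure SU2 1)) / (fpWeightBar L (powScale 1 β)) * (∫ u, φ u * (avgKernel ((L : ℝ) ^ 3 * β) u' u / transferKernel su2Rep ((L : ℝ) ^ 3 * β) (1 : GaugeConfig 3 1 SU2) 1) ∂configMeasure SU2 1)) with hψdef
  have hPm := measurable_slowP ((L : ℝ) ^ 3 * β) (transferKernel su2Rep ((L : ℝ) ^ 3 * β) (1 : GaugeConfig 3 1 SU2) 1) hφm
  have hψm : Measurable ψ := by rw [hψdef]; exact hPm.const_mul _
  obtain ⟨M1, -, hM1⟩ := exists_avgKernel_le (L := 1) ((L : ℝ) ^ 3 * β)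
  have hPb : ∀ u', |∫ u, φ u * (avgKernel ((L : ℝ) ^ 3 * β) u' u / transferKernel su2Rep ((L : ℝ) ^ 3 * β) (1 : GaugeConfig 3 1 SU2) 1) ∂configMeasure SU2 1| ≤ Cφ * (M1 / transferKernel su2Rep ((L : ℝ) ^ 3 * β) (1 : GaugeConfig 3 1 SU2) 1) :=
    fun u' => abs_slowP_le hK1 hCφ (fun u'' u => hM1 u'' u) u'
  have hCψ : ∀ u', |ψ u'| ≤ (fpZ (powScale 1 β))⁻¹ * (c₁ * stiffGaussTop L (β / 2) β / (∫ u, ({u : GaugeConfig 3 1 SU2 | (∀ k : Fin 3, ‖su2Quat (u (0, k)) - 1‖ ≤ (powScale (1 / 3) β)) ∧ (L : ℝ) ^ 3 * wilsonAction su2Rep u ≤ (powScale (1 / 2) β)}.indicator (fun _ => (1 : ℝ))) u * (transferKernel su2Rep ((L : ℝ) ^ 3 * β) (1 : GaugeConfig 3 1 SU2) u / transferKernel su2Rep ((L : ℝ) ^ 3 * β) (1 : GaugeConfig 3 1 SU2) 1) ∂configMeasure SU2 1)) / (fpWeightBar L (powScale 1 β)) * (Cφ * (M1 / transferKernel su2Rep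 ((L : ℝ) ^ 3 * β) (1 : GaugeConfig 3 1 SU2) 1)) := fun u' => by
    rw [hψdef]; dsimp only
    rw [abs_mul, abs_of_nonneg (by positivity : (0:ℝ) ≤ (fpZ (powScale 1 β))⁻¹ * (c₁ * stiffGaussTop L (β / 2) β / (∫ u, ({u : GaugeConfig 3 1 SU2 | (∀ k : Fin 3, ‖su2Quat (u (0, k)) - 1‖ ≤ (powScale (1 / 3) β)) ∧ (L : ℝ) ^ 3 * wilsonAction su2Rep u ≤ (powScale (1 / 2) β)}.indicator (fun _ => (1 : ℝ))) u * (transferKernel su2Rep ((L : ℝ) ^ 3 * β) (1 : GaugeConfig 3 1 SU2) u / transferKernel su2Rep ((L : ℝ) ^ 3 * β) (1 : GaugeConfig 3 1 SU2) 1) ∂configMeasure SU2 1)) / (fpWeightBar L (powScale 1 β)))]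
    exact mul_le_mul_of_nonneg_left (hPb u') (by positivity)
  -- `F` and `E`
  have hbom := measurable_boFun L hφm hΩm
  have hbob : ∀ V, |boFun L φ (fun x : LinkSpace L => {x : LinkSpace L | linkCurry x ∈ capBalancedSet L}.indicator (fun _ => (1 : ℝ)) x * frozenProfile L (fun β' => stiffGaussExp L (β' / 2) β') (fun β' => min (1 / 40) (powScale (1 / 2) β' * btLog β')) β x) V| ≤ Cφ * 1 := fun V => abs_boFun_le L hCφ hΩ1 V
  obtain ⟨hFm, ⟨CF, hCF⟩, -⟩ := integral_avgKernel_mul_props (L := L) β hbom hbob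
  have hSm : MeasurableSet {U : GaugeConfig 3 L SU2 | (recordChi L s 43 M β) U ≠ 0} := (hχm (measurableSet_singleton 0)).compl
  obtain ⟨hEm, hEb, hEid⟩ := defect_of_weight_lower_bound (L := L) hΩm hΩ1 hwm hSm hw₀ (fun U hU => hwS U hU) (v := (recordChi L s 43 M β)) (fun U hU => hU) hψm hCψ hFm hCF
  refine ⟨ψ, _, hψm, ⟨_, hCψ⟩, hEm, ⟨_, hEb⟩, hEid, ?_⟩
  -- the split
  have hsplit := record_defect_split (L := L) β (s := s) (M := M) (D := D) hφm hCφ hψm hCψ hw₀ hwS hsupp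
  -- piece 1: the core (relative)
  have h1 := hcore φ hφm Cφ hCφ hφs
  -- the floors in `Λ'` form
  have hflφ := hfl φ hφm Cφ hCφ hφs
  have hfl'φ := hfl' φ hφm Cφ hCφ hφs
  rw [← sigma_forms_eq] at hflφ hfl'φ
  -- piece 2: the FP tail against the `Z⁻²`-floor
  have h2 : ∫ U, {U : GaugeConfig 3 L SU2 | U ∈ orthoTubeSet L ∧ (recordChi L s 43 M β) U ≠ 0 ∧ ‖relLinkVec L U‖ ≤ (min (1 / 40) (powScale (1 / 2) β * btLog β)) / 12 ∧ slowMean L U ∈ {u : GaugeConfig 3 1 SU2 | (∀ k : Fin 3, ‖su2Quat (u (0, k)) - 1‖ ≤ (D * powScale s β)) ∧ (L : ℝ) ^ 3 * wilsonAction su2Rep u ≤ (powScale (2 * s) β)}}.indicator (fun _ => (1 : ℝ)) U * ((fun U : GaugeConfig 3 L SU2 => (fpZ (powScale 1 β))⁻¹ * ∫ u, φ u * (∫ c, fpFibreTransfer L β (fun x : LinkSpace L => {x : LinkSpace L | linkCurry x ∈ capBalancedSet L}.indicator (fun _ => (1 : ℝ)) x * frozenProfile L (fun β' => stiffGaussExp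 L (β' / 2) β') (fun β' => min (1 / 40) (powScale (1 / 2) β' * btLog β')) β x) (tailWeight L (powScale 1 β) (5 * (powScale (1 / 2) β * btLog β ^ 2))) (gaugeTransform (fun _ : Site 3 L => c⁻¹) U) u ∂haarProbability SU2) ∂configMeasure SU2 1) U ^ 2 / softWeight (recordChi L s 43 M β) U) ∂configMeasure SU2 L ≤ (Real.sqrt (((Real.exp (β * (2 * (Fintype.card (Edge 3 L) : ℝ))) * (Real.exp (-(β * btMnt L (Dδ * powScale s β) (powScale (1 / 2) β * btLog β ^ 2) (min (1 / 40) (powScale (1 / 2) β * btLog β)) (5 * (powScale (1 / 2) β * btLog β ^ 2)) (powScale 1 β))) + Real.exp (-(β * btMfar L (Dδ * powScale s β) (powScale (1 / 2) β * btLog β ^ 2) (min (1 / 40) (powScale (1 / 2) β * btLog β)) (powScale 1 β) (13 * (Dδ * powScale s β))))) * ∫ v, (fun x : LinkSpace L => {x : LinkSpace L | linkCurry x ∈ capBalancedSet L}.indicator (fun _ => (1 : ℝ)) x * frozenProfile L (fun β' => stiffGaussExp L (β' / 2) β') (fun β' => min (1 / 40) (powScale (1 / 2) β' * btLog β')) β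 x) (linkEmbed L v) ∂orthoTransverse L) ^ 2 * (1 / (fpWeightBar L (powScale 1 β) * (1 - (Cw * (43 * powScale s β) ^ 2))))) / (cR' * powScale 1 β ^ K' * (Real.exp (2 * β) ^ Fintype.card (Edge 3 L)) ^ 2)) * (btC L β (fun x : LinkSpace L => {x : LinkSpace L | linkCurry x ∈ capBalancedSet L}.indicator (fun _ => (1 : ℝ)) x * frozenProfile L (fun β' => stiffGaussExp L (β' / 2) β') (fun β' => min (1 / 40) (powScale (1 / 2) β' * btLog β')) β x) (powScale 1 β) (5 * (powScale (1 / 2) β * btLog β ^ 2)) * (fpZ (powScale 1 β))⁻¹ / recordGamma L (fun β' => fun x : LinkSpace L => {x : LinkSpace L | linkCurry x ∈ capBalancedSet L}.indicator (fun _ => (1 : ℝ)) x * frozenProfile L (fun β'' => stiffGaussExp L (β'' / 2) β'') (fun β'' => min (1 / 40) (powScale (1 / 2) β'' * btLog β'')) β' x) β * levelValue su2Rep 1 ((L : ℝ) ^ 3 * β) 0)) ^ 2 * tubeNormSq (softWeight (recordChi L s 43 M β)) (boFun L φ (fun x : LinkSpace L => {x : LinkSpace L | linkCurry x ∈ capBalancedSet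 L}.indicator (fun _ => (1 : ℝ)) x * frozenProfile L (fun β' => stiffGaussExp L (β' / 2) β') (fun β' => min (1 / 40) (powScale (1 / 2) β' * btLog β')) β x)) := by
    refine piece_le_rate_of_factor (Zq := (fpZ (powScale 1 β))⁻¹ ^ 2) (mul_pos (mul_pos hcR' (pow_pos (powScale_pos 1 β) _)) (by positivity)) (mul_nonneg (sq_nonneg _) hcg0) hfl'φ ?_
    calc ∫ U, {U : GaugeConfig 3 L SU2 | U ∈ orthoTubeSet L ∧ (recordChi L s 43 M β) U ≠ 0 ∧ ‖relLinkVec L U‖ ≤ (min (1 / 40) (powScale (1 / 2) β * btLog β)) / 12 ∧ slowMean L U ∈ {u : GaugeConfig 3 1 SU2 | (∀ k : Fin 3, ‖su2Quat (u (0, k)) - 1‖ ≤ (D * powScale s β)) ∧ (L : ℝ) ^ 3 * wilsonAction su2Rep u ≤ (powScale (2 * s) β)}}.indicator (fun _ => (1 : ℝ)) U * ((fun U : GaugeConfig 3 L SU2 => (fpZ (powScale 1 β))⁻¹ * ∫ u, φ u * (∫ c, fpFibreTransfer L β (fun x : LinkSpace L => {x : LinkSpace L | linkCurry x ∈ capBalancedSet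 L}.indicator (fun _ => (1 : ℝ)) x * frozenProfile L (fun β' => stiffGaussExp L (β' / 2) β') (fun β' => min (1 / 40) (powScale (1 / 2) β' * btLog β')) β x) (tailWeight L (powScale 1 β) (5 * (powScale (1 / 2) β * btLog β ^ 2))) (gaugeTransform (fun _ : Site 3 L => c⁻¹) U) u ∂haarProbability SU2) ∂configMeasure SU2 1) U ^ 2 / softWeight (recordChi L s 43 M β) U) ∂configMeasure SU2 L ≤ ((fpZ (powScale 1 β))⁻¹ * (Real.exp (β * (2 * (Fintype.card (Edge 3 L) : ℝ))) * (Real.exp (-(β * btMnt L (Dδ * powScale s β) (powScale (1 / 2) β * btLog β ^ 2) (min (1 / 40) (powScale (1 / 2) β * btLog β)) (5 * (powScale (1 / 2) β * btLog β ^ 2)) (powScale 1 β))) + Real.exp (-(β * btMfar L (Dδ * powScale s β) (powScale (1 / 2) β * btLog β ^ 2) (min (1 / 40) (powScale (1 / 2) β * btLog β)) (powScale 1 β) (13 * (Dδ * powScale s β))))) * ∫ v, (fun x : LinkSpace L => {x : LinkSpace L | linkCurry x ∈ capBalancedSet L}.indicator (fun _ => (1 : ℝ)) x * frozenProfile L (fun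 β' => stiffGaussExp L (β' / 2) β') (fun β' => min (1 / 40) (powScale (1 / 2) β' * btLog β')) β x) (linkEmbed L v) ∂orthoTransverse L)) ^ 2 * (1 / (fpWeightBar L (powScale 1 β) * (1 - (Cw * (43 * powScale s β) ^ 2)))) * ∫ u, φ u ^ 2 ∂configMeasure SU2 1 := htail φ hφm Cφ hCφ hφs
      _ = ((Real.exp (β * (2 * (Fintype.card (Edge 3 L) : ℝ))) * (Real.exp (-(β * btMnt L (Dδ * powScale s β) (powScale (1 / 2) β * btLog β ^ 2) (min (1 / 40) (powScale (1 / 2) β * btLog β)) (5 * (powScale (1 / 2) β * btLog β ^ 2)) (powScale 1 β))) + Real.exp (-(β * btMfar L (Dδ * powScale s β) (powScale (1 / 2) β * btLog β ^ 2) (min (1 / 40) (powScale (1 / 2) β * btLog β)) (powScale 1 β) (13 * (Dδ * powScale s β))))) * ∫ v, (fun x : LinkSpace L => {x : LinkSpace L | linkCurry x ∈ capBalancedSet L}.indicator (fun _ => (1 : ℝ)) x * frozenProfile L (fun β' => stiffGaussExp L (β' / 2) β') (fun β' => min (1 / 40) (powScale (1 / 2) β' * btLog β')) β x) (linkEmbed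 L v) ∂orthoTransverse L) ^ 2 * (1 / (fpWeightBar L (powScale 1 β) * (1 - (Cw * (43 * powScale s β) ^ 2))))) * (fpZ (powScale 1 β))⁻¹ ^ 2 * ∫ u, φ u ^ 2 ∂configMeasure SU2 1 := by ring
  -- piece 3: the outer region against the plain floor
  have hOS0 : 0 ≤ ((Real.exp (2 * β) ^ Fintype.card (Edge 3 L)) ^ 2 * (Real.exp (-(β * (2 - 2 * Real.cos (2 * Real.pi / L)) * ((min (1 / 40) (powScale (1 / 2) β * btLog β)) / 12 / 2) ^ 2)) + Real.exp (-(((powScale 1 β) * btLog β) ^ 2 / powScale 1 β ^ 2)) ^ 2 + Real.exp (-(((powScale 1 β) * btLog β) ^ 2 / powScale 1 β ^ 2))) + (Real.exp (2 * β) ^ Fintype.card (Edge 3 L)) * ((Real.exp (2 * β) ^ Fintype.card (Edge 3 L)) * Real.exp (-(β * ((min (1 / 40) (powScale (1 / 2) β * btLog β)) / 1000) ^ 2)))) := by positivity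
  have h3 : ∫ U, (orthoTubeSet L ∩ {U | (recordChi L s 43 M β) U ≠ 0} ∩ {U | (min (1 / 40) (powScale (1 / 2) β * btLog β)) / 12 < ‖relLinkVec L U‖}).indicator (fun _ => (1 : ℝ)) U * ((∫ V, avgKernel β U V * boFun L φ (fun x : LinkSpace L => {x : LinkSpace L | linkCurry x ∈ capBalancedSet L}.indicator (fun _ => (1 : ℝ)) x * frozenProfile L (fun β' => stiffGaussExp L (β' / 2) β') (fun β' => min (1 / 40) (powScale (1 / 2) β' * btLog β')) β x) V ∂configMeasure SU2 L) ^ 2 / softWeight (recordChi L s 43 M β) U) ∂configMeasure SU2 L ≤ (Real.sqrt ((3 * ((orthoTransverse L Set.univ).toReal * (1 / (fpWeightBar L (powScale 1 β) * (1 - (Cw * (43 * powScale s β) ^ 2)))) * ((Real.exp (2 * β) ^ Fintype.card (Edge 3 L)) ^ 2 * (Real.exp (-(β * (2 - 2 * Real.cos (2 * Real.pi / L)) * ((min (1 / 40) (powScale (1 / 2) β * btLog β)) / 12 / 2) ^ 2)) + Real.exp (-(((powScale 1 β) * btLog β) ^ 2 / powScale 1 β ^ 2)) ^ 2 + Real.exp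 (-(((powScale 1 β) * btLog β) ^ 2 / powScale 1 β ^ 2))) + (Real.exp (2 * β) ^ Fintype.card (Edge 3 L)) * ((Real.exp (2 * β) ^ Fintype.card (Edge 3 L)) * Real.exp (-(β * ((min (1 / 40) (powScale (1 / 2) β * btLog β)) / 1000) ^ 2)))))) / (cR * powScale 1 β ^ K * (Real.exp (2 * β) ^ Fintype.card (Edge 3 L)) ^ 2)) * (btC L β (fun x : LinkSpace L => {x : LinkSpace L | linkCurry x ∈ capBalancedSet L}.indicator (fun _ => (1 : ℝ)) x * frozenProfile L (fun β' => stiffGaussExp L (β' / 2) β') (fun β' => min (1 / 40) (powScale (1 / 2) β' * btLog β')) β x) (powScale 1 β) (5 * (powScale (1 / 2) β * btLog β ^ 2)) * (fpZ (powScale 1 β))⁻¹ / recordGamma L (fun β' => fun x : LinkSpace L => {x : LinkSpace L | linkCurry x ∈ capBalancedSet L}.indicator (fun _ => (1 : ℝ)) x * frozenProfile L (fun β'' => stiffGaussExp L (β'' / 2) β'') (fun β'' => min (1 / 40) (powScale (1 / 2) β'' * btLog β'')) β' x) β * levelValue su2Rep 1 ((L : ℝ) ^ 3 * β) 0)) ^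 2 * tubeNormSq (softWeight (recordChi L s 43 M β)) (boFun L φ (fun x : LinkSpace L => {x : LinkSpace L | linkCurry x ∈ capBalancedSet L}.indicator (fun _ => (1 : ℝ)) x * frozenProfile L (fun β' => stiffGaussExp L (β' / 2) β') (fun β' => min (1 / 40) (powScale (1 / 2) β' * btLog β')) β x)) := by
    refine piece_le_rate (mul_pos (mul_pos hcR (pow_pos (powScale_pos 1 β) _)) (by positivity)) (mul_nonneg (by norm_num) (mul_nonneg (mul_nonneg hPm0 hcg0) hOS0)) hflφ ?_
    calc ∫ U, (orthoTubeSet L ∩ {U | (recordChi L s 43 M β) U ≠ 0} ∩ {U | (min (1 / 40) (powScale (1 / 2) β * btLog β)) / 12 < ‖relLinkVec L U‖}).indicator (fun _ => (1 : ℝ)) U * ((∫ V, avgKernel β U V * boFun L φ (fun x : LinkSpace L => {x : LinkSpace L | linkCurry x ∈ capBalancedSet L}.indicator (fun _ => (1 : ℝ)) x * frozenProfile L (fun β' => stiffGaussExp L (β' / 2) β') (fun β' => min (1 / 40) (powScale (1 / 2) β' * btLog β')) β x) V ∂configMeasure SU2 L) ^ 2 / softWeight (recordChi L s 43 M β) U)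 ∂configMeasure SU2 L ≤ 3 * ((orthoTransverse L Set.univ).toReal * (1 / (fpWeightBar L (powScale 1 β) * (1 - (Cw * (43 * powScale s β) ^ 2)))) * ((Real.exp (2 * β) ^ Fintype.card (Edge 3 L)) ^ 2 * (Real.exp (-(β * (2 - 2 * Real.cos (2 * Real.pi / L)) * ((min (1 / 40) (powScale (1 / 2) β * btLog β)) / 12 / 2) ^ 2)) + Real.exp (-(((powScale 1 β) * btLog β) ^ 2 / powScale 1 β ^ 2)) ^ 2 + Real.exp (-(((powScale 1 β) * btLog β) ^ 2 / powScale 1 β ^ 2))) + (Real.exp (2 * β) ^ Fintype.card (Edge 3 L)) * ((Real.exp (2 * β) ^ Fintype.card (Edge 3 L)) * Real.exp (-(β * ((min (1 / 40) (powScale (1 / 2) β * btLog β)) / 1000) ^ 2)))) * ∫ u, φ u ^ 2 ∂configMeasure SU2 1) := hout φ hφm Cφ hCφ hφs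
      _ = (3 * ((orthoTransverse L Set.univ).toReal * (1 / (fpWeightBar L (powScale 1 β) * (1 - (Cw * (43 * powScale s β) ^ 2)))) * ((Real.exp (2 * β) ^ Fintype.card (Edge 3 L)) ^ 2 * (Real.exp (-(β * (2 - 2 * Real.cos (2 * Real.pi / L)) * ((min (1 / 40) (powScale (1 / 2) β * btLog β)) / 12 / 2) ^ 2)) + Real.exp (-(((powScale 1 β) * btLog β) ^ 2 / powScale 1 β ^ 2)) ^ 2 + Real.exp (-(((powScale 1 β) * btLog β) ^ 2 / powScale 1 β ^ 2))) + (Real.exp (2 * β) ^ Fintype.card (Edge 3 L)) * ((Real.exp (2 * β) ^ Fintype.card (Edge 3 L)) * Real.exp (-(β * ((min (1 / 40) (powScale (1 / 2) β * btLog β)) / 1000) ^ 2)))))) * ∫ u, φ u ^ 2 ∂configMeasure SU2 1 := by ring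
  -- piece 4: the shell in relative currency
  have h4 : ∫ U, (orthoTubeSet L ∩ {U | (recordChi L s 43 M β) U ≠ 0} ∩ {U | (min (1 / 40) (powScale (1 / 2) β * btLog β)) / 12 < ‖relLinkVec L U‖}).indicator (fun _ => (1 : ℝ)) U * (boFun L (fun u' => (fpZ (powScale 1 β))⁻¹ * (c₁ * stiffGaussTop L (β / 2) β / (∫ u, ({u : GaugeConfig 3 1 SU2 | (∀ k : Fin 3, ‖su2Quat (u (0, k)) - 1‖ ≤ (powScale (1 / 3) β)) ∧ (L : ℝ) ^ 3 * wilsonAction su2Rep u ≤ (powScale (1 / 2) β)}.indicator (fun _ => (1 : ℝ))) u * (transferKernel su2Rep ((L : ℝ) ^ 3 * β) (1 : GaugeConfig 3 1 SU2) u / transferKernel su2Rep ((L : ℝ) ^ 3 * β) (1 : GaugeConfig 3 1 SU2) 1) ∂configMeasure SU2 1)) / (fpWeightBar L (powScale 1 β)) * (∫ u, φ u * (avgKernel ((L : ℝ) ^ 3 * β) u' u / transferKernel su2Rep ((L : ℝ) ^ 3 * β) (1 : GaugeConfig 3 1 SU2) 1) ∂configMeasure SU2 1)) (fun x : LinkSpace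 L => {x : LinkSpace L | linkCurry x ∈ capBalancedSet L}.indicator (fun _ => (1 : ℝ)) x * frozenProfile L (fun β' => stiffGaussExp L (β' / 2) β') (fun β' => min (1 / 40) (powScale (1 / 2) β' * btLog β')) β x) U ^ 2 * softWeight (recordChi L s 43 M β) U) ∂configMeasure SU2 L ≤ (Real.sqrt (8 * (fpWeightBar L (powScale 1 β) * (1 + (Cw * (43 * powScale s β) ^ 2))) * (Real.exp (-(β * (2 - 2 * Real.cos (2 * Real.pi / L)) * ((min (1 / 40) (powScale (1 / 2) β * btLog β)) / 12) ^ 2)) * (orthoTransverse L Set.univ).toReal) / ((1 - powScale (1 / 5) β) ^ 2 * (1 - (Cn * (43 * powScale s β) ^ 2)) * (∫ v, {v : Edge 3 L → Fin 3 → ℝ | ‖linkEmbed L v‖ ≤ (min (1 / 40) (powScale (1 / 2) β * btLog β)) / 12}.indicator (fun _ => (1 : ℝ)) v * (Real.exp (-(stiffGaussExp L (β / 2) β (linkEmbed L v))) ^ 2 * Real.exp (-(‖(gaugeModes L).starProjection (linkEmbed L v)‖ ^ 2 / powScale 1 β ^ 2))) ∂orthoTransverse L) * fpWeightBar L (powScale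 1 β))) * (btC L β (fun x : LinkSpace L => {x : LinkSpace L | linkCurry x ∈ capBalancedSet L}.indicator (fun _ => (1 : ℝ)) x * frozenProfile L (fun β' => stiffGaussExp L (β' / 2) β') (fun β' => min (1 / 40) (powScale (1 / 2) β' * btLog β')) β x) (powScale 1 β) (5 * (powScale (1 / 2) β * btLog β ^ 2)) * (fpZ (powScale 1 β))⁻¹ / recordGamma L (fun β' => fun x : LinkSpace L => {x : LinkSpace L | linkCurry x ∈ capBalancedSet L}.indicator (fun _ => (1 : ℝ)) x * frozenProfile L (fun β'' => stiffGaussExp L (β'' / 2) β'') (fun β'' => min (1 / 40) (powScale (1 / 2) β'' * btLog β'')) β' x) β * levelValue su2Rep 1 ((L : ℝ) ^ 3 * β) 0)) ^ 2 * tubeNormSq (softWeight (recordChi L s 43 M β)) (boFun L φ (fun x : LinkSpace L => {x : LinkSpace L | linkCurry x ∈ capBalancedSet L}.indicator (fun _ => (1 : ℝ)) x * frozenProfile L (fun β' => stiffGaussExp L (β' / 2) β') (fun β' => min (1 / 40) (powScale (1 / 2) β' * btLog β')) β x)) := by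
    have hsh : ∫ U, (orthoTubeSet L ∩ {U | (recordChi L s 43 M β) U ≠ 0} ∩ {U | (min (1 / 40) (powScale (1 / 2) β * btLog β)) / 12 < ‖relLinkVec L U‖}).indicator (fun _ => (1 : ℝ)) U * (boFun L (fun u' => (fpZ (powScale 1 β))⁻¹ * (c₁ * stiffGaussTop L (β / 2) β / (∫ u, ({u : GaugeConfig 3 1 SU2 | (∀ k : Fin 3, ‖su2Quat (u (0, k)) - 1‖ ≤ (powScale (1 / 3) β)) ∧ (L : ℝ) ^ 3 * wilsonAction su2Rep u ≤ (powScale (1 / 2) β)}.indicator (fun _ => (1 : ℝ))) u * (transferKernel su2Rep ((L : ℝ) ^ 3 * β) (1 : GaugeConfig 3 1 SU2) u / transferKernel su2Rep ((L : ℝ) ^ 3 * β) (1 : GaugeConfig 3 1 SU2) 1) ∂configMeasure SU2 1)) / (fpWeightBar L (powScale 1 β)) * (∫ u, φ u * (avgKernel ((L : ℝ) ^ 3 * β) u' u / transferKernel su2Rep ((L : ℝ) ^ 3 * β) (1 : GaugeConfig 3 1 SU2) 1) ∂configMeasure SU2 1)) (fun x : LinkSpace L => {x : LinkSpace L | linkCurry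 x ∈ capBalancedSet L}.indicator (fun _ => (1 : ℝ)) x * frozenProfile L (fun β' => stiffGaussExp L (β' / 2) β') (fun β' => min (1 / 40) (powScale (1 / 2) β' * btLog β')) β x) U ^ 2 * softWeight (recordChi L s 43 M β) U) ∂configMeasure SU2 L ≤ (fpWeightBar L (powScale 1 β) * (1 + (Cw * (43 * powScale s β) ^ 2))) * (Real.exp (-(β * (2 - 2 * Real.cos (2 * Real.pi / L)) * ((min (1 / 40) (powScale (1 / 2) β * btLog β)) / 12) ^ 2)) * (orthoTransverse L Set.univ).toReal) * (((fpZ (powScale 1 β))⁻¹ * (c₁ * stiffGaussTop L (β / 2) β / (∫ u, ({u : GaugeConfig 3 1 SU2 | (∀ k : Fin 3, ‖su2Quat (u (0, k)) - 1‖ ≤ (powScale (1 / 3) β)) ∧ (L : ℝ) ^ 3 * wilsonAction su2Rep u ≤ (powScale (1 / 2) β)}.indicator (fun _ => (1 : ℝ))) u * (transferKernel su2Rep ((L : ℝ) ^ 3 * β) (1 : GaugeConfig 3 1 SU2) u / transferKernel su2Rep ((L : ℝ) ^ 3 * β) (1 : GaugeConfig 3 1 SU2) 1) ∂configMeasure SU2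 1)) / (fpWeightBar L (powScale 1 β))) ^ 2 * ((linkCE ((L : ℝ) ^ 3 * β) / transferKernel su2Rep ((L : ℝ) ^ 3 * β) (1 : GaugeConfig 3 1 SU2) 1) ^ 2 * ∫ u, φ u ^ 2 ∂configMeasure SU2 1)) := by
      calc ∫ U, (orthoTubeSet L ∩ {U | (recordChi L s 43 M β) U ≠ 0} ∩ {U | (min (1 / 40) (powScale (1 / 2) β * btLog β)) / 12 < ‖relLinkVec L U‖}).indicator (fun _ => (1 : ℝ)) U * (boFun L (fun u' => (fpZ (powScale 1 β))⁻¹ * (c₁ * stiffGaussTop L (β / 2) β / (∫ u, ({u : GaugeConfig 3 1 SU2 | (∀ k : Fin 3, ‖su2Quat (u (0, k)) - 1‖ ≤ (powScale (1 / 3) β)) ∧ (L : ℝ) ^ 3 * wilsonAction su2Rep u ≤ (powScale (1 / 2) β)}.indicator (fun _ => (1 : ℝ))) u * (transferKernel su2Rep ((L : ℝ) ^ 3 * β) (1 : GaugeConfig 3 1 SU2) u / transferKernel su2Rep ((L : ℝ) ^ 3 * β) (1 : GaugeConfig 3 1 SU2) 1) ∂configMeasure SU2 1)) / (fpWeightBar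 L (powScale 1 β)) * (∫ u, φ u * (avgKernel ((L : ℝ) ^ 3 * β) u' u / transferKernel su2Rep ((L : ℝ) ^ 3 * β) (1 : GaugeConfig 3 1 SU2) 1) ∂configMeasure SU2 1)) (fun x : LinkSpace L => {x : LinkSpace L | linkCurry x ∈ capBalancedSet L}.indicator (fun _ => (1 : ℝ)) x * frozenProfile L (fun β' => stiffGaussExp L (β' / 2) β') (fun β' => min (1 / 40) (powScale (1 / 2) β' * btLog β')) β x) U ^ 2 * softWeight (recordChi L s 43 M β) U) ∂configMeasure SU2 L ≤ _ := hshell φ hφm Cφ hCφ hφs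
        _ = _ := by ring
    have hNhi : 0 ≤ (fpWeightBar L (powScale 1 β) * (1 + (Cw * (43 * powScale s β) ^ 2))) := mul_nonneg hNb.le (by positivity)
    have hG : 0 ≤ (Real.exp (-(β * (2 - 2 * Real.cos (2 * Real.pi / L)) * ((min (1 / 40) (powScale (1 / 2) β * btLog β)) / 12) ^ 2)) * (orthoTransverse L Set.univ).toReal) := mul_nonneg (Real.exp_pos _).le hPm0
    exact sq_le_of_shell_currency hZi ha₀ hNhi hG hNb hM2 hK1 hφ2 hη hKN hγ0 hCE0 hsh hbtC (hnorm φ hφm Cφ hCφ hφs) hγ2 hCE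
  -- assemble
  exact defect_bound_of_pieces hsplit h1 h2 h3 h4

end Summit.QuantumFields.YangMills.Theorems.FemtoTransferGap.TwoLattice.ConstTube

end
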